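/-
Copyright (c) 2026 the pub-hodgecm-mathlib formalisation cell (harness21).  Prover seat hodgecm-mathlib-K2E5-p10 (g4), Track B «K2-LIT» ∕ h413
(`stmt-HodgeConjecture-24833`), line `K2_E3_EllipticInputs`, unit U12, §L leaf (LBGL-2b) brick (b-ii)/(Q), part 1: SQUARES IN A NON-ARCHIMEDEAN LOCAL FIELD —
Hensel for `h² + a h = y`, the squares are open, the squaring map near `±1`, and the `F ↔ Fˣ` measure dictionary on the unit sphere.  2026-09-04.
-/
import Literature.NumberTheory.Automorphic.LocalFieldHaarBalls      -- ★ `normAbs` kit, `primePowBall`, `map_mul_left_addHaar`, `isHaarMeasure_unitsMeasure`, `measurableEmbedding_unitsVal`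
import Literature.NumberTheory.Automorphic.AddCharConductorExponent -- ★ `normAbs_neg`
import Mathlib.RingTheory.Henselian
import HarnessLib

/-!
# K2_E3 road (h413), §L brick (Q) part 1 — squares in a non-archimedean local field: Hensel, openness, the squaring map near `±1`

Cell `pub/hodgecm-mathlib` (D-0151), Track B, seat K2E5-p10 (g4) (free E5 hand on the E3 §L line; §L lead K2E3-p12 (g4), dealer K2E3-plan (g2)).
`--supports stmt-HodgeConjecture-24833 --as helper`; THEOREMS ONLY (no definition ∕ instance ∕ notation ∕ named fact ∕ `sorry`); never imports
`Cruxes/…/Lines`.  COUNT-NEUTRAL.  First half of the one-dimensional change of variables behind the Lie–Weyl formula for the Borel slice of `𝔤𝔩₂(F)`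
(leaf (LBGL-2b) of U12, after ★ p856988); the push-forward theorem itself is the sequel `K2E3LocalFieldSquarePushforward`.
* §1 HENSEL: `h² + a h = y` is solvable with `‖h‖ ‖a‖ = ‖y‖` whenever `‖y‖ < ‖a‖²` (Newton's lemma for `X² + X − y∕a²` in the `𝓂`-adically complete ring
  `𝒪[F]`, Mathlib `IsAdicComplete.henselianRing` — valid in EVERY residue characteristic); hence every `z` with `‖z − 1‖ < ‖2‖²` is a square, and the
  non-zero squares form an open subset of `F` (characteristic `≠ 2`) and an open subgroup of `Fˣ`;
* §2 the squaring map near `±1`: for `r < ‖2‖²`, `‖z² − 1‖ ≤ r ⟺ ‖z − 1‖ ≤ r∕‖2‖ ∨ ‖z + 1‖ ≤ r∕‖2‖`, the two balls being disjoint;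
* §3 measure dictionary: on subsets of the unit sphere the multiplicative Haar measure `d×u = du∕‖u‖` (★ `isHaarMeasure_unitsMeasure`) is `du`; shell blocks
  `{a ≤ ‖u‖ ≤ b}` have finite `d×u`-measure; closed balls: translation, dilation `μ{‖x‖ ≤ r∕‖a‖} = ‖a‖⁻¹ μ{‖x‖ ≤ r}`, positivity and finiteness.
[Serre1973CourseArithmetic, Ch. II §3.3 (squares in `ℚ_pˣ`)] [NeukirchANT1999, Ch. II §4 Lemma (4.6) (Hensel)] [Tate1950, §2.2–2.3]
HONEST LABEL: HC_CM is proved only modulo the 7 printed citations (2 remaining named inputs: hLiu418 = stmt-HodgeConjecture-24832, h413 =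
stmt-HodgeConjecture-24833) until rung 0 closes; count-neutral helper toward (LBGL-2b); (L-B_GL) :478 of U12 stays OPEN.

## References
* [Serre1973CourseArithmetic] J.-P. Serre, *A Course in Arithmetic* (1973), Ch. II §3.3.
* [NeukirchANT1999] J. Neukirch, *Algebraic Number Theory* (1999), Ch. II §4 Lemma (4.6) (Hensel).
* [Tate1950] J. Tate, *Fourier analysis in number fields and Hecke's zeta-functions* (1950), §2.2–2.3 (`d×x = dx∕‖x‖`, `μ(aE) = ‖a‖μ(E)`).
-/

set_option autoImplicit false
set_option linter.dupNamespace false   -- `Summit.HodgeConjecture.HodgeConjecture.…` (D-0017 nested layout; lakefile exemption for Summits)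

noncomputable section

open MeasureTheory Measure Filter Topology Set
open scoped NNReal ENNReal Pointwise
open ValuativeRel
open Literature.NumberTheory.Automorphic Literature.NumberTheory.Automorphic.LocalFieldHaar
open Literature.NumberTheory.GaloisRepresentations Literature.NumberTheory.GaloisRepresentations.IsNonarchimedeanLocalField

namespace Summit.HodgeConjecture.HodgeConjecture.Cruxes.H413.K2E3LocalFieldSquaresHensel

variable {F : Type*} [Field F] [ValuativeRel F] [TopologicalSpace F] [IsNonarchimedeanLocalField F]

/-! ## §1  Hensel: `h² + a h = y` with `‖h‖ ‖a‖ = ‖y‖` for `‖y‖ < ‖a‖²` -/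

/-- **Newton's lemma for `X² + X − c`**: if `‖c‖ < 1` then `k² + k = c` for some `k` with `‖k‖ = ‖c‖` (`𝒪[F]` is `𝓂`-adically complete, hence
henselian, Mathlib `IsAdicComplete.henselianRing`; the derivative at `0` is `1`). [cite: NeukirchANT1999, Ch. II §4 Lemma (4.6)] -/
theorem exists_sq_add_self_eq {c : F} (hc : normAbs F c < 1) : ∃ k : F, k ^ 2 + k = c ∧ normAbs F k = normAbs F c := by
  letI : UniformSpace F := IsTopologicalAddGroup.rightUniformSpace F
  haveI : IsUniformAddGroup F := isUniformAddGroup_of_addCommGroup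
  have hc1 : c ∈ 𝒪[F] := normAbs_le_one_iff.1 hc.le
  set c' : 𝒪[F] := ⟨c, hc1⟩ with hc'
  have hcm : c' ∈ 𝓂[F] := normAbs_lt_one_iff_mem_maximalIdeal.1 (by simpa [hc'] using hc)
  set f : Polynomial 𝒪[F] := Polynomial.X ^ 2 + Polynomial.X - Polynomial.C c' with hf
  have hmonic : f.Monic := by
    have h : f = Polynomial.X ^ 2 + (Polynomial.X - Polynomial.C c') := by rw [hf]; ring
    rw [h]
    refine (Polynomial.monic_X_pow 2).add_of_left ?_
    rw [Polynomial.degree_X_pow]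
    exact (Polynomial.degree_X_sub_C _).trans_lt (by norm_num)
  have h0 : f.eval 0 ∈ 𝓂[F] := by
    have h : f.eval 0 = -c' := by rw [hf]; simp
    rw [h]
    exact neg_mem hcm
  have h1 : IsUnit (Ideal.Quotient.mk 𝓂[F] (f.derivative.eval 0)) := by
    have h : f.derivative.eval 0 = 1 := by rw [hf]; simp
    rw [h, map_one]; exact isUnit_one
  obtain ⟨Z, hZ, hZ0⟩ := HenselianRing.is_henselian (I := 𝓂[F]) f hmonic 0 h0 h1
  have hZ' : (Z : F) ^ 2 + Z = c := by
    have h := hZ.eq_zero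
    rw [hf, Polynomial.eval_sub, Polynomial.eval_add, Polynomial.eval_pow, Polynomial.eval_X, Polynomial.eval_C, sub_eq_zero] at h
    have := congrArg ((↑) : 𝒪[F] → F) h
    simpa [hc'] using this
  refine ⟨Z, hZ', ?_⟩
  -- `‖Z‖ < 1` (as `Z ∈ 𝓂`), so `‖Z + 1‖ = 1` and `‖c‖ = ‖Z‖ ‖Z + 1‖ = ‖Z‖`
  have hZm : (Z : 𝒪[F]) ∈ 𝓂[F] := by simpa using hZ0
  have hZlt : normAbs F (Z : F) < 1 := normAbs_lt_one_iff_mem_maximalIdeal.2 hZm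
  have hZ1 : normAbs F ((Z : F) + 1) = 1 := by
    have h := normAbs_add_eq_of_lt (a := (1 : F)) (t := (Z : F)) (by rwa [map_one])
    rwa [add_comm, map_one] at h
  have : c = (Z : F) * ((Z : F) + 1) := by rw [← hZ']; ring
  rw [this, map_mul, hZ1, mul_one]

/-- **Hensel for `h² + a h = y`**: if `a ≠ 0` and `‖y‖ < ‖a‖²` then some `h` solves `h² + a h = y` with `‖h‖ ‖a‖ = ‖y‖` (substitute `h = a k`,
`k² + k = y∕a²`). [cite: NeukirchANT1999, Ch. II §4 Lemma (4.6)] -/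
theorem exists_sq_add_mul_eq {a y : F} (ha : a ≠ 0) (hy : normAbs F y < normAbs F a ^ 2) :
    ∃ h : F, h ^ 2 + a * h = y ∧ normAbs F h * normAbs F a = normAbs F y := by
  have ha0 : 0 < normAbs F a := pos_iff_ne_zero.2 ((map_ne_zero (normAbs F)).2 ha)
  have hc : normAbs F (y / a ^ 2) < 1 := by
    rw [map_div₀, map_pow, div_lt_one (pow_pos ha0 2)]
    exact hy
  obtain ⟨k, hk, hkn⟩ := exists_sq_add_self_eq hc
  refine ⟨a * k, ?_, ?_⟩
  · have h2 : a ^ 2 ≠ 0 := pow_ne_zero 2 ha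
    have : a ^ 2 * (k ^ 2 + k) = y := by rw [hk, mul_div_cancel₀ _ h2]
    rw [← this]; ring
  · rw [map_mul, hkn, map_div₀, map_pow]
    field_simp

/-- **Squares near `1`**: if `‖z − 1‖ < ‖2‖²` then `z` is a square (`z = (1 + h)²` with `h² + 2h = z − 1`). [cite: Serre1973CourseArithmetic, Ch. II §3.3] -/
theorem isSquare_of_normAbs_sub_one_lt (h2 : (2 : F) ≠ 0) {z : F} (hz : normAbs F (z - 1) < normAbs F 2 ^ 2) : IsSquare z := by
  obtain ⟨h, hh, -⟩ := exists_sq_add_mul_eq h2 hz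
  exact ⟨1 + h, by linear_combination (-1 : F) * hh⟩

/-- **Squares near a non-zero square**: if `x₀ = u₀² ≠ 0` and `‖x − x₀‖ < ‖2‖² ‖x₀‖` then `x` is a square. [cite: Serre1973CourseArithmetic, Ch. II §3.3] -/
theorem isSquare_of_normAbs_sub_lt (h2 : (2 : F) ≠ 0) {x x₀ : F} (hx₀ : IsSquare x₀) (h0 : x₀ ≠ 0)
    (h : normAbs F (x - x₀) < normAbs F 2 ^ 2 * normAbs F x₀) : IsSquare x := by
  have hn0 : 0 < normAbs F x₀ := pos_iff_ne_zero.2 ((map_ne_zero (normAbs F)).2 h0)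
  have hz : normAbs F (x / x₀ - 1) < normAbs F 2 ^ 2 := by
    have : x / x₀ - 1 = (x - x₀) / x₀ := by field_simp
    rw [this, map_div₀, div_lt_iff₀ hn0]
    exact h
  obtain ⟨w, hw⟩ := isSquare_of_normAbs_sub_one_lt h2 hz
  obtain ⟨u₀, hu₀⟩ := hx₀
  refine ⟨w * u₀, ?_⟩
  have : x = (x / x₀) * x₀ := by rw [div_mul_cancel₀ _ h0]
  rw [this, hw, hu₀]; ring

/-- **The non-zero squares form an open subset of `F`** (characteristic `≠ 2`). [cite: Serre1973CourseArithmetic, Ch. II §3.3] -/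
theorem isOpen_setOf_isSquare_and_ne_zero (h2 : (2 : F) ≠ 0) : IsOpen {x : F | IsSquare x ∧ x ≠ 0} := by
  rw [isOpen_iff_mem_nhds]
  rintro x₀ ⟨hx₀, h0⟩
  have hn0 : 0 < normAbs F x₀ := pos_iff_ne_zero.2 ((map_ne_zero (normAbs F)).2 h0)
  have h20 : 0 < normAbs F 2 := pos_iff_ne_zero.2 ((map_ne_zero (normAbs F)).2 h2)
  -- the open set `{x | ‖x − x₀‖ < min (‖2‖² ‖x₀‖) ‖x₀‖}` is a neighbourhood of `x₀` made of non-zero squares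
  have hcont : Continuous fun x : F => normAbs F (x - x₀) := continuous_normAbs.comp (continuous_id.sub continuous_const)
  have hU : {x : F | normAbs F (x - x₀) < min (normAbs F 2 ^ 2 * normAbs F x₀) (normAbs F x₀)} ∈ 𝓝 x₀ := by
    refine (isOpen_lt hcont continuous_const).mem_nhds ?_
    simp only [mem_setOf_eq, sub_self, map_zero]
    exact lt_min (mul_pos (pow_pos h20 2) hn0) hn0
  refine Filter.mem_of_superset hU fun x hx => ?_
  simp only [mem_setOf_eq, lt_min_iff] at hx
  refine ⟨isSquare_of_normAbs_sub_lt h2 hx₀ h0 hx.1, fun hx0 => ?_⟩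
  rw [hx0, zero_sub, normAbs_neg] at hx
  exact lt_irrefl _ hx.2


/-! ## §2  The squaring map near `±1`: `{z | ‖z² − 1‖ ≤ r} = {‖z − 1‖ ≤ r∕‖2‖} ⊔ {‖z + 1‖ ≤ r∕‖2‖}` for `r < ‖2‖²` -/

/-- For `‖z − 1‖ < ‖2‖`: `‖z² − 1‖ = ‖2‖ ‖z − 1‖` (`z² − 1 = (z − 1)(2 + (z − 1))`). [cite: Serre1973CourseArithmetic, Ch. II §3.3] -/
theorem normAbs_sq_sub_one_eq {z : F} (hz : normAbs F (z - 1) < normAbs F 2) :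
    normAbs F (z ^ 2 - 1) = normAbs F 2 * normAbs F (z - 1) := by
  have h : z ^ 2 - 1 = (2 + (z - 1)) * (z - 1) := by ring
  rw [h, map_mul, normAbs_add_eq_of_lt hz]

/-- **The preimage of a small ball around `1` under squaring**: for `0 ≤ r < ‖2‖²`, `‖z² − 1‖ ≤ r` iff `‖z − 1‖ ≤ r∕‖2‖` or `‖z + 1‖ ≤ r∕‖2‖`.
[cite: Serre1973CourseArithmetic, Ch. II §3.3] -/
theorem normAbs_sq_sub_one_le_iff (h2 : (2 : F) ≠ 0) {r : ℝ≥0} (hr : r < normAbs F 2 ^ 2) (z : F) :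
    normAbs F (z ^ 2 - 1) ≤ r ↔ normAbs F (z - 1) ≤ r / normAbs F 2 ∨ normAbs F (z + 1) ≤ r / normAbs F 2 := by
  have h20 : 0 < normAbs F 2 := pos_iff_ne_zero.2 ((map_ne_zero (normAbs F)).2 h2)
  have hr2 : r / normAbs F 2 < normAbs F 2 := by
    rw [div_lt_iff₀ h20, ← sq]; exact hr
  constructor
  · intro hle
    -- `max (‖z − 1‖, ‖z + 1‖) ≥ ‖2‖`
    have hfac : normAbs F (z - 1) * normAbs F (z + 1) ≤ r := by
      rw [← map_mul, show (z - 1) * (z + 1) = z ^ 2 - 1 by ring]; exact hle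
    by_cases hp : normAbs F 2 ≤ normAbs F (z + 1)
    · left
      rw [le_div_iff₀ h20]
      exact (mul_le_mul_of_nonneg_left hp (by positivity)).trans hfac
    · right
      push Not at hp
      have hm : normAbs F 2 ≤ normAbs F (z - 1) := by
        have h := normAbs_add_le_max (z + 1) (-(z - 1))
        rw [show z + 1 + -(z - 1) = (2 : F) by ring, normAbs_neg] at h
        rcases le_max_iff.1 h with h' | h'
        · exact absurd h' (not_le.2 hp)
        · exact h'
      rw [le_div_iff₀ h20]
      calc normAbs F (z + 1) * normAbs F 2 ≤ normAbs F (z + 1) * normAbs F (z - 1) := mul_le_mul_of_nonneg_left hm (by positivity)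
        _ = normAbs F (z - 1) * normAbs F (z + 1) := mul_comm _ _
        _ ≤ r := hfac
  · rintro (h | h)
    · have hlt : normAbs F (z - 1) < normAbs F 2 := lt_of_le_of_lt h hr2
      rw [normAbs_sq_sub_one_eq hlt, mul_comm, ← le_div_iff₀ h20]; exact h
    · have hlt : normAbs F (-z - 1) < normAbs F 2 := by
        rw [show -z - 1 = -(z + 1) by ring, normAbs_neg]; exact lt_of_le_of_lt h hr2
      have := normAbs_sq_sub_one_eq hlt
      rw [neg_sq, show -z - 1 = -(z + 1) by ring, normAbs_neg] at this
      rw [this, mul_comm, ← le_div_iff₀ h20]; exact h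

/-- The two balls `{‖z − 1‖ ≤ r∕‖2‖}` and `{‖z + 1‖ ≤ r∕‖2‖}` are disjoint for `r < ‖2‖²`. [cite: Serre1973CourseArithmetic, Ch. II §3.3] -/
theorem not_normAbs_sub_one_le_and_add_one_le (h2 : (2 : F) ≠ 0) {r : ℝ≥0} (hr : r < normAbs F 2 ^ 2) (z : F) :
    ¬ (normAbs F (z - 1) ≤ r / normAbs F 2 ∧ normAbs F (z + 1) ≤ r / normAbs F 2) := by
  have h20 : 0 < normAbs F 2 := pos_iff_ne_zero.2 ((map_ne_zero (normAbs F)).2 h2)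
  have hr2 : r / normAbs F 2 < normAbs F 2 := by
    rw [div_lt_iff₀ h20, ← sq]; exact hr
  rintro ⟨h1, h1'⟩
  have h := normAbs_add_le_max (z + 1) (-(z - 1))
  rw [show z + 1 + -(z - 1) = (2 : F) by ring, normAbs_neg] at h
  rcases le_max_iff.1 h with h' | h'
  · exact absurd (h'.trans h1') (not_le.2 hr2)
  · exact absurd (h'.trans h1) (not_le.2 hr2)

/-! ## §3  The push-forward of `d×u` under `u ↦ u²` -/

omit [TopologicalSpace F] [IsNonarchimedeanLocalField F] [ValuativeRel F] in
/-- A unit of `F` is a square in `Fˣ` iff it is a square in `F`. [folklore] -/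
theorem isSquare_units_iff (u : Fˣ) : IsSquare u ↔ IsSquare (u : F) := by
  constructor
  · rintro ⟨r, hr⟩; exact ⟨r, by rw [hr, Units.val_mul]⟩
  · rintro ⟨r, hr⟩
    have hr0 : r ≠ 0 := by rintro rfl; exact u.ne_zero (by rw [hr, mul_zero])
    exact ⟨Units.mk0 r hr0, Units.ext (by rw [Units.val_mul]; exact hr)⟩

omit [TopologicalSpace F] [IsNonarchimedeanLocalField F] [ValuativeRel F] in
/-- The squares of `Fˣ` are the range of the squaring homomorphism. [folklore] -/
theorem coe_range_powMonoidHom_two : ((powMonoidHom 2 : Fˣ →* Fˣ).range : Set Fˣ) = {u : Fˣ | IsSquare u} := by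
  ext u
  simp only [SetLike.mem_coe, MonoidHom.mem_range, powMonoidHom_apply, mem_setOf_eq]
  constructor
  · rintro ⟨r, rfl⟩; exact ⟨r, sq r⟩
  · rintro ⟨r, hr⟩; exact ⟨r, by rw [hr, sq]⟩

/-- **The squares form an open subgroup of `Fˣ`** (characteristic `≠ 2`). [cite: Serre1973CourseArithmetic, Ch. II §3.3] -/
theorem isOpen_setOf_isSquare_units (h2 : (2 : F) ≠ 0) : IsOpen {u : Fˣ | IsSquare u} := by
  have h : {u : Fˣ | IsSquare u} = ((↑) : Fˣ → F) ⁻¹' {x : F | IsSquare x ∧ x ≠ 0} := by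
    ext u
    simp only [mem_setOf_eq, mem_preimage, isSquare_units_iff, u.ne_zero, ne_eq, not_false_eq_true, and_true]
  rw [h]
  exact (isOpen_setOf_isSquare_and_ne_zero h2).preimage Units.continuous_val

section Measure

variable [MeasurableSpace F] [BorelSpace F] (μ : Measure F) [μ.IsAddHaarMeasure]

omit [μ.IsAddHaarMeasure] in
/-- On subsets of the unit sphere the multiplicative Haar measure `d×u = du∕‖u‖` IS `du`: `ν(A) = μ(A)` for `A ⊆ {‖u‖ = 1}`. [folklore] -/
theorem unitsMeasure_apply_eq_of_subset_sphere {A : Set Fˣ} (hA : MeasurableSet A) (h1 : ∀ u ∈ A, normAbs F (u : F) = 1) :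
    Measure.comap ((↑) : Fˣ → F) (μ.withDensity fun x => (((normAbs F x)⁻¹ : ℝ≥0) : ℝ≥0∞)) A = μ (((↑) : Fˣ → F) '' A) := by
  have hme := measurableEmbedding_unitsVal (F := F)
  have hAm : MeasurableSet (((↑) : Fˣ → F) '' A) := hme.measurableSet_image.2 hA
  rw [hme.comap_apply, withDensity_apply _ hAm]
  have h : ∀ x ∈ ((↑) : Fˣ → F) '' A, (((normAbs F x)⁻¹ : ℝ≥0) : ℝ≥0∞) = 1 := by
    rintro x ⟨u, hu, rfl⟩
    rw [h1 u hu, inv_one, ENNReal.coe_one]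
  rw [setLIntegral_congr_fun hAm h, setLIntegral_const, one_mul]

/-- The multiplicative Haar measure of a «shell block» `{u | a ≤ ‖u‖ ≤ b}` (`0 < a`) is finite: it is at most `a⁻¹ · μ{‖x‖ ≤ b}`. [folklore] -/
theorem unitsMeasure_setOf_le_normAbs_le_lt_top {a b : ℝ≥0} (ha : 0 < a) :
    Measure.comap ((↑) : Fˣ → F) (μ.withDensity fun x => (((normAbs F x)⁻¹ : ℝ≥0) : ℝ≥0∞))
      {u : Fˣ | a ≤ normAbs F (u : F) ∧ normAbs F (u : F) ≤ b} < ∞ := by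
  haveI : T2Space F := (isLocalField F).toT2Space
  have hme := measurableEmbedding_unitsVal (F := F)
  set A : Set Fˣ := {u : Fˣ | a ≤ normAbs F (u : F) ∧ normAbs F (u : F) ≤ b} with hAdef
  have hA : MeasurableSet A := by
    haveI : BorelSpace Fˣ := Units.borelSpace
    have hc : Measurable fun u : Fˣ => normAbs F (u : F) := (continuous_normAbs.comp Units.continuous_val).measurable
    rw [hAdef, setOf_and]
    exact (measurableSet_le (measurable_const (a := a)) hc).inter (measurableSet_le hc (measurable_const (a := b)))
  have hAm : MeasurableSet (((↑) : Fˣ → F) '' A) := hme.measurableSet_image.2 hA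
  rw [hme.comap_apply, withDensity_apply _ hAm]
  -- on the image the density is `≤ a⁻¹`, and the image lies in the compact ball `{‖x‖ ≤ b}`
  have hle : ∫⁻ x in ((↑) : Fˣ → F) '' A, (((normAbs F x)⁻¹ : ℝ≥0) : ℝ≥0∞) ∂μ ≤
      ∫⁻ x in ((↑) : Fˣ → F) '' A, ((a⁻¹ : ℝ≥0) : ℝ≥0∞) ∂μ := by
    refine setLIntegral_mono measurable_const fun x hx => ?_
    obtain ⟨u, hu, rfl⟩ := hx
    exact ENNReal.coe_le_coe.2 (inv_anti₀ ha hu.1)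
  refine lt_of_le_of_lt hle ?_
  rw [setLIntegral_const]
  refine ENNReal.mul_lt_top ENNReal.coe_lt_top ?_
  -- `val '' A ⊆ {x | ‖x‖ ≤ b} ⊆ 𝔭^{-n}` for `q^n > b`, a compact ball
  have hq : 1 < (residueFieldCard F : ℝ≥0) := by exact_mod_cast one_lt_residueFieldCard F
  obtain ⟨n, hn⟩ := pow_unbounded_of_one_lt b hq
  have hsub : ((↑) : Fˣ → F) '' A ⊆ primePowBall F (-(n : ℤ)) := by
    rintro x ⟨u, hu, rfl⟩
    show normAbs F (u : F) ≤ ((residueFieldCard F : ℝ≥0)⁻¹) ^ (-(n : ℤ))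
    rw [zpow_neg, inv_zpow, inv_inv, zpow_natCast]
    exact hu.2.trans hn.le
  exact (measure_mono hsub).trans_lt (isCompact_primePowBall (-(n : ℤ))).measure_lt_top

/-- The measure of a closed ball `{‖x − a‖ ≤ r}` does not depend on its centre. [folklore] -/
theorem measure_setOf_normAbs_sub_le (a : F) (r : ℝ≥0) :
    μ {x : F | normAbs F (x - a) ≤ r} = μ {x : F | normAbs F x ≤ r} := by
  have h : {x : F | normAbs F (x - a) ≤ r} = (fun x => -a + x) ⁻¹' {x : F | normAbs F x ≤ r} := by
    ext x; simp only [mem_setOf_eq, mem_preimage, neg_add_eq_sub]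
  rw [h, measure_preimage_add]

/-- Dilating a closed ball: `μ{‖x‖ ≤ r∕‖a‖} = ‖a‖⁻¹ μ{‖x‖ ≤ r}` for `a ≠ 0`. [cite: Tate1950, §2.2 Lemma 2.2.5] -/
theorem measure_setOf_normAbs_le_div {a : F} (ha : a ≠ 0) (r : ℝ≥0) :
    μ {x : F | normAbs F x ≤ r / normAbs F a} = ((normAbs F a)⁻¹ : ℝ≥0) * μ {x : F | normAbs F x ≤ r} := by
  have ha0 : 0 < normAbs F a := pos_iff_ne_zero.2 ((map_ne_zero (normAbs F)).2 ha)
  have h : {x : F | normAbs F x ≤ r / normAbs F a} = (fun x => a * x) ⁻¹' {x : F | normAbs F x ≤ r} := by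
    ext x
    simp only [mem_setOf_eq, mem_preimage, map_mul]
    rw [le_div_iff₀ ha0, mul_comm]
  have hm : MeasurableSet {x : F | normAbs F x ≤ r} := measurableSet_le continuous_normAbs.measurable measurable_const
  rw [h, ← Measure.map_apply (measurable_const_mul a) hm, map_mul_left_addHaar μ ha, Measure.smul_apply, smul_eq_mul, map_inv₀]

omit [BorelSpace F] in
/-- A closed ball `{‖x‖ ≤ r}` with `0 < r` has positive, finite Haar measure. [folklore] -/
theorem measure_setOf_normAbs_le_pos_lt_top {r : ℝ≥0} (hr : 0 < r) :
    0 < μ {x : F | normAbs F x ≤ r} ∧ μ {x : F | normAbs F x ≤ r} < ∞ := by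
  haveI : T2Space F := (isLocalField F).toT2Space
  constructor
  · have ho : IsOpen {x : F | normAbs F x < r} := isOpen_lt continuous_normAbs continuous_const
    exact lt_of_lt_of_le (ho.measure_pos μ ⟨0, by simp [hr]⟩) (measure_mono fun x (hx : normAbs F x < r) => hx.le)
  · have hq : 1 < (residueFieldCard F : ℝ≥0) := by exact_mod_cast one_lt_residueFieldCard F
    obtain ⟨n, hn⟩ := pow_unbounded_of_one_lt r hq
    have hsub : {x : F | normAbs F x ≤ r} ⊆ primePowBall F (-(n : ℤ)) := by
      intro x hx
      show normAbs F x ≤ ((residueFieldCard F : ℝ≥0)⁻¹) ^ (-(n : ℤ))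
      rw [zpow_neg, inv_zpow, inv_inv, zpow_natCast]
      exact hx.trans hn.le
    exact (measure_mono hsub).trans_lt (isCompact_primePowBall (-(n : ℤ))).measure_lt_top

end Measure

end Summit.HodgeConjecture.HodgeConjecture.Cruxes.H413.K2E3LocalFieldSquaresHensel

end
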